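import Mathlib.Analysis.Calculus.MeanValue
import Mathlib.Analysis.SpecialFunctions.Log.Deriv
import Mathlib.Analysis.SpecialFunctions.ExpDeriv
import Mathlib.Analysis.SpecialFunctions.Pow.Real
import Mathlib.Analysis.SpecialFunctions.Sqrt
import Summits.CriticalPhenomena.PercolationContinuityZ3.Theorems.PercNearOneGluingNoHeavyLowerTailAPLFamilyPhi
import HarnessLib

/-!
# `NoHeavyLowerTail` (stmt-CriticalPhenomena-4575) — the ADMISSIBLE FAMILY of profile rows, part 4: from a member of the family to a λ-row of APL-G (the ray-convexity lemma)

Support file (prover prim-ineq-gen-8 gen 38; `--supports stmt-CriticalPhenomena-4575`; memo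
run/shared/lean/prim/prim-ineq-gen-8/FINDING-gen38-APLG-ALL.md §2).  Pure real analysis: no definitions, no named facts, no sorries.

APL-G `(TD − e)² ≤ u_ab·u_ac` (gen 29) is the conjunction of its λ-rows `2(TD − e) ≤ λ·u_ab + u_ac/λ`, `λ > 0`.  With `x = u_ab/u0`, `y = u_ac/u0`
an admissible row `U^{α+β} ≤ A·B^β·C^α` (`…APLFamilyAll`) says `A ≥ (1+x)^{−α}(1+y)^{−β}`, hence `2(TD−e)/u0 = 2(1 − A(1+x+y)) ≤
2 − 2(1+x+y)(1+x)^{−α}(1+y)^{−β}`, and the λ-row follows from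
* **`ray_ineq`** — for an admissible pair and `2(α−1) ≤ λ`, `2(β−1)·λ ≤ 1`:  `λx + y/λ − 2 + 2(1+x+y)/((1+x)^α(1+y)^β) ≥ 0` for all `x, y ≥ 0`.
  Proof: along `t ↦ (tx, ty)` the function `g(t)` vanishes at `0`, `g'(0) = x(λ−2(α−1)) + y(1/λ−2(β−1)) ≥ 0`, and `g'' = 2h(w'' + w'²) ≥ 0` where
  `w'' + w'² = (p − αq₁ − βq₂)² − p² + αq₁² + βq₂² ≥ Q_{αβ}(q₁,q₂) ≥ 0` (`ray_form_nonneg`; `p = (x+y)/(1+t(x+y)) ≤ q₁ + q₂`,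
  `q₁ = x/(1+tx)`, `q₂ = y/(1+ty)`) — the SAME quadratic form as in LEMMA Q_{αβ} (`famQ_nonneg`);
* `lambdaRow_of_row` — the cell-level consequence: row ⟹ `2(u0 − (u0+ubc)(u0+uab+uac)) ≤ λ·uab + uac/λ`;
* `fam_member_*` — the boundary member `β = (s²+3)/(s²−1)`, `α = (s²+3)/(2(s+1))` (`s ≥ 3`) is admissible with window `[(s−1)²/(s+1), (s²−1)/8] ∋ λ`,
  and `s = sqrt(8λ+1)` serves a given `λ ≥ 1`;
* `sq_le_of_forall_lambda` — bookkeeping: `H > 0`, `p > 0`, `2H ≤ (H/p)·p + q/(H/p)` give `H² ≤ p·q`.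
[this work]
-/

namespace Summit.CriticalPhenomena.PercolationContinuityZ3.Theorems

namespace APL

/-! ### The algebraic heart: the same form `Q_{αβ}` -/

/-- `(p − αq₁ − βq₂)² − p² + αq₁² + βq₂² = Q_{αβ}(q₁,q₂) + 2(q₁+q₂−p)(αq₁+βq₂) ≥ 0` for `0 ≤ p ≤ q₁+q₂`, `q₁, q₂ ≥ 0` and an admissible
pair. [this work] -/
theorem ray_form_nonneg (α β p q₁ q₂ : ℝ) (hα : 1 ≤ α) (hβ : 1 ≤ β) (hadm : (α + β) ^ 2 ≤ α * β * (α + β + 1))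
    (hq₁ : 0 ≤ q₁) (hq₂ : 0 ≤ q₂) (hp : p ≤ q₁ + q₂) :
    0 ≤ (p - α * q₁ - β * q₂) ^ 2 - p ^ 2 + α * q₁ ^ 2 + β * q₂ ^ 2 := by
  have hQ := famQ_nonneg α β q₁ q₂ hα hadm
  have key : (p - α * q₁ - β * q₂) ^ 2 - p ^ 2 + α * q₁ ^ 2 + β * q₂ ^ 2
      = (α * (α - 1) * q₁ ^ 2 + 2 * (α * β - α - β) * (q₁ * q₂) + β * (β - 1) * q₂ ^ 2)
        + 2 * (q₁ + q₂ - p) * (α * q₁ + β * q₂) := by ring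
  rw [key]
  have h2 : 0 ≤ 2 * (q₁ + q₂ - p) * (α * q₁ + β * q₂) :=
    mul_nonneg (mul_nonneg (by norm_num) (sub_nonneg.2 hp))
      (add_nonneg (mul_nonneg (by linarith) hq₁) (mul_nonneg (by linarith) hq₂))
  linarith

/-! ### Calculus along the ray -/

/-- `d/dt log(1 + t·c) = c/(1 + t·c)`. [folklore] -/
theorem hasDerivAt_log_one_add (c t : ℝ) (h : 1 + t * c ≠ 0) :
    HasDerivAt (fun t => Real.log (1 + t * c)) (c / (1 + t * c)) t := by
  have h1 : HasDerivAt (fun t => 1 + t * c) (1 * c) t := ((hasDerivAt_id' t).mul_const c).const_add 1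
  refine (h1.log h).congr_deriv ?_
  ring

/-- `d/dt [c/(1 + t·c)] = −c²/(1 + t·c)²`. [folklore] -/
theorem hasDerivAt_frac_one_add (c t : ℝ) (h : 1 + t * c ≠ 0) :
    HasDerivAt (fun t => c / (1 + t * c)) (-c ^ 2 / (1 + t * c) ^ 2) t := by
  have h1 : HasDerivAt (fun t => 1 + t * c) (1 * c) t := ((hasDerivAt_id' t).mul_const c).const_add 1
  have h2 := (h1.inv h).const_mul c
  refine (h2.congr_of_eventuallyEq ?_).congr_deriv ?_
  · exact Filter.Eventually.of_forall fun y => by simp [div_eq_mul_inv]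
  · field_simp

/-- Subadditivity of `u ↦ u/(1+tu)`: `(x+y)/(1+t(x+y)) ≤ x/(1+tx) + y/(1+ty)` for `t, x, y ≥ 0`. [folklore] -/
theorem frac_subadd (t x y : ℝ) (ht : 0 ≤ t) (hx : 0 ≤ x) (hy : 0 ≤ y) :
    (x + y) / (1 + t * (x + y)) ≤ x / (1 + t * x) + y / (1 + t * y) := by
  have dx : 0 < 1 + t * x := by positivity
  have dy : 0 < 1 + t * y := by positivity
  have ds : 0 < 1 + t * (x + y) := by positivity
  have e : (x + y) / (1 + t * (x + y)) = x / (1 + t * (x + y)) + y / (1 + t * (x + y)) := by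
    rw [← add_div]
  rw [e]
  refine add_le_add ?_ ?_
  · exact div_le_div_of_nonneg_left hx dx (by nlinarith)
  · exact div_le_div_of_nonneg_left hy dy (by nlinarith)

set_option maxHeartbeats 1600000 in
/-- **The ray-convexity lemma** (memo §2), in `exp/log` form.  For an admissible pair `(α,β)` and `λ > 0` with `2(α−1) ≤ λ` and
`2(β−1)λ ≤ 1`, and all `x, y ≥ 0`:
`0 ≤ λx + y/λ − 2 + 2·exp(log(1+x+y) − α·log(1+x) − β·log(1+y))`.
Proof: `g(t) := λtx + ty/λ − 2 + 2e^{w(t)}`, `w(t) = log(1+t(x+y)) − α log(1+tx) − β log(1+ty)`, has `g(0) = 0`,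
`g'(0) = x(λ − 2(α−1)) + y(1/λ − 2(β−1)) ≥ 0` and `g'' = 2e^{w}(w'' + w'²) ≥ 0` (`ray_form_nonneg`, `frac_subadd`); so `g' ≥ 0` and `g(1) ≥ 0`.
[this work] -/
theorem ray_ineq_exp (α β lam x y : ℝ) (hα : 1 ≤ α) (hβ : 1 ≤ β) (hadm : (α + β) ^ 2 ≤ α * β * (α + β + 1))
    (hlam : 0 < lam) (hwa : 2 * (α - 1) ≤ lam) (hwb : 2 * (β - 1) * lam ≤ 1) (hx : 0 ≤ x) (hy : 0 ≤ y) :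
    0 ≤ lam * x + y / lam - 2 + 2 * Real.exp (Real.log (1 + x + y) - α * Real.log (1 + x) - β * Real.log (1 + y)) := by
  -- the functions along the ray `t ↦ (tx, ty)`
  set w : ℝ → ℝ := fun t => Real.log (1 + t * (x + y)) - α * Real.log (1 + t * x) - β * Real.log (1 + t * y) with hwdef
  set w1 : ℝ → ℝ := fun t => (x + y) / (1 + t * (x + y)) - α * (x / (1 + t * x)) - β * (y / (1 + t * y)) with hw1def
  set w2 : ℝ → ℝ := fun t => -(x + y) ^ 2 / (1 + t * (x + y)) ^ 2 - α * (-x ^ 2 / (1 + t * x) ^ 2)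
      - β * (-y ^ 2 / (1 + t * y) ^ 2) with hw2def
  set g : ℝ → ℝ := fun t => lam * t * x + t * y / lam - 2 + 2 * Real.exp (w t) with hgdef
  set g1 : ℝ → ℝ := fun t => lam * x + y / lam + 2 * (Real.exp (w t) * w1 t) with hg1def
  set g2 : ℝ → ℝ := fun t => 2 * (Real.exp (w t) * w1 t * w1 t + Real.exp (w t) * w2 t) with hg2def
  -- positivity of the affine arguments for `t ≥ 0`
  have pos : ∀ t : ℝ, 0 ≤ t → 0 < 1 + t * (x + y) ∧ 0 < 1 + t * x ∧ 0 < 1 + t * y := by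
    intro t ht; exact ⟨by positivity, by positivity, by positivity⟩
  -- derivatives
  have dw : ∀ t : ℝ, 0 ≤ t → HasDerivAt w (w1 t) t := by
    intro t ht
    obtain ⟨p1, p2, p3⟩ := pos t ht
    have h := ((hasDerivAt_log_one_add (x + y) t p1.ne').sub ((hasDerivAt_log_one_add x t p2.ne').const_mul α)).sub
      ((hasDerivAt_log_one_add y t p3.ne').const_mul β)
    exact h
  have dw1 : ∀ t : ℝ, 0 ≤ t → HasDerivAt w1 (w2 t) t := by
    intro t ht
    obtain ⟨p1, p2, p3⟩ := pos t ht
    exact ((hasDerivAt_frac_one_add (x + y) t p1.ne').sub ((hasDerivAt_frac_one_add x t p2.ne').const_mul α)).sub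
      ((hasDerivAt_frac_one_add y t p3.ne').const_mul β)
  have dg : ∀ t : ℝ, 0 ≤ t → HasDerivAt g (g1 t) t := by
    intro t ht
    have h1 : HasDerivAt (fun t => lam * t * x) (lam * x) t := by
      have := ((hasDerivAt_id' t).const_mul lam).mul_const x
      simpa using this
    have h2 : HasDerivAt (fun t => t * y / lam) (y / lam) t := by
      have := ((hasDerivAt_id' t).mul_const y).div_const lam
      simpa using this
    have h3 : HasDerivAt (fun t => 2 * Real.exp (w t)) (2 * (Real.exp (w t) * w1 t)) t := ((dw t ht).exp).const_mul 2
    have h := ((h1.add h2).sub (hasDerivAt_const t (2 : ℝ))).add h3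
    refine h.congr_deriv ?_
    simp only [hg1def]
    ring
  have dg1 : ∀ t : ℝ, 0 ≤ t → HasDerivAt g1 (g2 t) t := by
    intro t ht
    have h3 : HasDerivAt (fun t => Real.exp (w t) * w1 t) (Real.exp (w t) * w1 t * w1 t + Real.exp (w t) * w2 t) t :=
      ((dw t ht).exp).mul (dw1 t ht)
    have h := (h3.const_mul 2).const_add (lam * x + y / lam)
    exact h
  -- the second derivative is nonnegative
  have g2nn : ∀ t : ℝ, 0 ≤ t → 0 ≤ g2 t := by
    intro t ht
    obtain ⟨p1, p2, p3⟩ := pos t ht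
    have hform : w1 t * w1 t + w2 t
        = ((x + y) / (1 + t * (x + y)) - α * (x / (1 + t * x)) - β * (y / (1 + t * y))) ^ 2
          - ((x + y) / (1 + t * (x + y))) ^ 2 + α * (x / (1 + t * x)) ^ 2 + β * (y / (1 + t * y)) ^ 2 := by
      simp only [hw1def, hw2def]
      rw [div_pow, div_pow, div_pow]
      ring
    have hnn : 0 ≤ w1 t * w1 t + w2 t := by
      rw [hform]
      exact ray_form_nonneg α β _ _ _ hα hβ hadm (div_nonneg hx p2.le) (div_nonneg hy p3.le) (frac_subadd t x y ht hx hy)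
    have e : g2 t = 2 * (Real.exp (w t) * (w1 t * w1 t + w2 t)) := by simp only [hg2def]; ring
    rw [e]
    exact mul_nonneg (by norm_num) (mul_nonneg (Real.exp_pos _).le hnn)
  -- `g1` is non-decreasing on `[0,1]`, hence `g1 ≥ g1 0 ≥ 0` there
  have g1cont : ContinuousOn g1 (Set.Icc 0 1) :=
    fun t ht => (dg1 t ht.1).continuousAt.continuousWithinAt
  have g1mono : MonotoneOn g1 (Set.Icc 0 1) := by
    refine monotoneOn_of_deriv_nonneg (convex_Icc 0 1) g1cont ?_ ?_
    · rw [interior_Icc]; intro t ht; exact (dg1 t ht.1.le).differentiableAt.differentiableWithinAt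
    · rw [interior_Icc]; intro t ht; rw [(dg1 t ht.1.le).deriv]; exact g2nn t ht.1.le
  have g10 : 0 ≤ g1 0 := by
    have e : g1 0 = x * (lam - 2 * (α - 1)) + y * (1 / lam - 2 * (β - 1)) := by
      simp only [hg1def, hw1def, hwdef]
      simp
      ring
    rw [e]
    have hb' : 0 ≤ 1 / lam - 2 * (β - 1) := by
      rw [sub_nonneg, le_div_iff₀ hlam]; linarith
    exact add_nonneg (mul_nonneg hx (sub_nonneg.2 hwa)) (mul_nonneg hy hb')
  have g1nn : ∀ t ∈ Set.Icc (0 : ℝ) 1, 0 ≤ g1 t := fun t ht =>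
    g10.trans (g1mono ⟨le_rfl, zero_le_one⟩ ht ht.1)
  -- `g` is non-decreasing on `[0,1]`, hence `g 1 ≥ g 0 = 0`
  have gcont : ContinuousOn g (Set.Icc 0 1) :=
    fun t ht => (dg t ht.1).continuousAt.continuousWithinAt
  have gmono : MonotoneOn g (Set.Icc 0 1) := by
    refine monotoneOn_of_deriv_nonneg (convex_Icc 0 1) gcont ?_ ?_
    · rw [interior_Icc]; intro t ht; exact (dg t ht.1.le).differentiableAt.differentiableWithinAt
    · rw [interior_Icc]; intro t ht; rw [(dg t ht.1.le).deriv]; exact g1nn t ⟨ht.1.le, ht.2.le⟩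
  have g0 : g 0 = 0 := by simp only [hgdef, hwdef]; simp
  have h01 := gmono ⟨le_rfl, zero_le_one⟩ ⟨zero_le_one, le_rfl⟩ zero_le_one
  rw [g0] at h01
  have e1 : g 1 = lam * x + y / lam - 2 + 2 * Real.exp (Real.log (1 + x + y) - α * Real.log (1 + x) - β * Real.log (1 + y)) := by
    simp only [hgdef, hwdef]; ring_nf
  rw [e1] at h01
  exact h01

/-- The ray-convexity lemma in `rpow` form: `0 ≤ λx + y/λ − 2 + 2(1+x+y)/((1+x)^α(1+y)^β)`. [this work] -/
theorem ray_ineq (α β lam x y : ℝ) (hα : 1 ≤ α) (hβ : 1 ≤ β) (hadm : (α + β) ^ 2 ≤ α * β * (α + β + 1))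
    (hlam : 0 < lam) (hwa : 2 * (α - 1) ≤ lam) (hwb : 2 * (β - 1) * lam ≤ 1) (hx : 0 ≤ x) (hy : 0 ≤ y) :
    0 ≤ lam * x + y / lam - 2 + 2 * ((1 + x + y) / ((1 + x) ^ α * (1 + y) ^ β)) := by
  have h := ray_ineq_exp α β lam x y hα hβ hadm hlam hwa hwb hx hy
  have hx1 : 0 < 1 + x := by linarith
  have hy1 : 0 < 1 + y := by linarith
  have hs1 : 0 < 1 + x + y := by linarith
  have e : Real.exp (Real.log (1 + x + y) - α * Real.log (1 + x) - β * Real.log (1 + y))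
      = (1 + x + y) / ((1 + x) ^ α * (1 + y) ^ β) := by
    rw [Real.exp_sub, Real.exp_sub, Real.exp_log hs1, Real.rpow_def_of_pos hx1, Real.rpow_def_of_pos hy1,
      mul_comm α, mul_comm β, div_div]
  rw [e] at h
  linarith [h]

/-! ### From a row of the family to a λ-row of APL-G (cells) -/

/-- **Row ⟹ λ-row.**  For an admissible pair, `λ > 0` in its window, and cells `u0 > 0`, `uab, uac, ubc ≥ 0`: the row
`u0^{α+β} ≤ (u0+ubc)·(u0+uac)^β·(u0+uab)^α` implies `2·(u0 − (u0+ubc)(u0+uab+uac)) ≤ λ·uab + uac/λ`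
(the left side is `2(TD − e)` when the cells sum to one, `…APLGeometricClosure.harrisDefect_eq_cells`). [this work] -/
theorem lambdaRow_of_row (α β lam u0 uab uac ubc : ℝ) (hα : 1 ≤ α) (hβ : 1 ≤ β) (hadm : (α + β) ^ 2 ≤ α * β * (α + β + 1))
    (hlam : 0 < lam) (hwa : 2 * (α - 1) ≤ lam) (hwb : 2 * (β - 1) * lam ≤ 1)
    (hu0 : 0 < u0) (huab : 0 ≤ uab) (huac : 0 ≤ uac)
    (hrow : u0 ^ (α + β) ≤ (u0 + ubc) * (u0 + uac) ^ β * (u0 + uab) ^ α) :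
    2 * (u0 - (u0 + ubc) * (u0 + uab + uac)) ≤ lam * uab + uac / lam := by
  have hα0 : 0 ≤ α := zero_le_one.trans hα
  have hβ0 : 0 ≤ β := zero_le_one.trans hβ
  set x := uab / u0 with hxdef
  set y := uac / u0 with hydef
  have hx : 0 ≤ x := div_nonneg huab hu0.le
  have hy : 0 ≤ y := div_nonneg huac hu0.le
  have exab : u0 + uab = u0 * (1 + x) := by rw [hxdef]; field_simp
  have exac : u0 + uac = u0 * (1 + y) := by rw [hydef]; field_simp
  have eD : u0 + uab + uac = u0 * (1 + x + y) := by rw [hxdef, hydef]; field_simp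
  have hx1 : 0 < 1 + x := by linarith
  have hy1 : 0 < 1 + y := by linarith
  -- the row in normalised form: `1 ≤ (u0+ubc)·(1+y)^β·(1+x)^α`
  have hE : 0 < (1 + x) ^ α * (1 + y) ^ β := mul_pos (Real.rpow_pos_of_pos hx1 α) (Real.rpow_pos_of_pos hy1 β)
  have hrow' : 1 ≤ (u0 + ubc) * ((1 + x) ^ α * (1 + y) ^ β) := by
    rw [exab, exac, Real.mul_rpow hu0.le hy1.le, Real.mul_rpow hu0.le hx1.le, Real.rpow_add hu0] at hrow
    have hpos : 0 < u0 ^ α * u0 ^ β := mul_pos (Real.rpow_pos_of_pos hu0 α) (Real.rpow_pos_of_pos hu0 β)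
    have h2 : u0 ^ α * u0 ^ β * 1 ≤ u0 ^ α * u0 ^ β * ((u0 + ubc) * ((1 + x) ^ α * (1 + y) ^ β)) := by
      refine (by ring : u0 ^ α * u0 ^ β * 1 = u0 ^ α * u0 ^ β).trans_le (hrow.trans_eq (by ring))
    exact le_of_mul_le_mul_left h2 hpos
  have hA : (1 + x + y) / ((1 + x) ^ α * (1 + y) ^ β) ≤ (u0 + ubc) * (1 + x + y) := by
    rw [div_le_iff₀ hE]
    have : 0 ≤ 1 + x + y := by linarith
    nlinarith [mul_le_mul_of_nonneg_left hrow' this]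
  have hray := ray_ineq α β lam x y hα hβ hadm hlam hwa hwb hx hy
  -- `2(u0 − (u0+ubc)·u0(1+x+y)) = u0·(2 − 2(u0+ubc)(1+x+y)) ≤ u0·(λx + y/λ) = λ uab + uac/λ`
  have h1 : 2 - 2 * ((u0 + ubc) * (1 + x + y)) ≤ lam * x + y / lam := by linarith
  have h2 := mul_le_mul_of_nonneg_left h1 hu0.le
  have e1 : u0 * (2 - 2 * ((u0 + ubc) * (1 + x + y))) = 2 * (u0 - (u0 + ubc) * (u0 + uab + uac)) := by rw [eD]; ring
  have e2 : u0 * (lam * x + y / lam) = lam * uab + uac / lam := by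
    rw [hxdef, hydef]; field_simp
  rw [e1, e2] at h2
  exact h2

/-! ### The boundary member serving a given `λ ≥ 1` -/

/-- The boundary member `β = (s²+3)/(s²−1)`, `α = (s²+3)/(2(s+1))` (`s ≥ 3`) is admissible (`α, β ≥ 1`, `(α+β)² = αβ(α+β+1)`), and
`λ = (s²−1)/8` lies in its window: `2(α−1) = (s−1)²/(s+1) ≤ λ`, `2(β−1)λ = 1`. [this work] -/
theorem fam_member (s : ℝ) (hs : 3 ≤ s) :
    1 ≤ (s ^ 2 + 3) / (2 * (s + 1)) ∧ 1 ≤ (s ^ 2 + 3) / (s ^ 2 - 1) ∧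
      ((s ^ 2 + 3) / (2 * (s + 1)) + (s ^ 2 + 3) / (s ^ 2 - 1)) ^ 2
        ≤ (s ^ 2 + 3) / (2 * (s + 1)) * ((s ^ 2 + 3) / (s ^ 2 - 1)) * ((s ^ 2 + 3) / (2 * (s + 1)) + (s ^ 2 + 3) / (s ^ 2 - 1) + 1) ∧
      2 * ((s ^ 2 + 3) / (2 * (s + 1)) - 1) ≤ (s ^ 2 - 1) / 8 ∧
      2 * ((s ^ 2 + 3) / (s ^ 2 - 1) - 1) * ((s ^ 2 - 1) / 8) ≤ 1 := by
  have h1 : 0 < s + 1 := by linarith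
  have h2 : 0 < s - 1 := by linarith
  have h3 : 0 < s ^ 2 - 1 := by nlinarith
  have h3' : s ^ 2 - 1 = (s - 1) * (s + 1) := by ring
  refine ⟨?_, ?_, ?_, ?_, ?_⟩
  · rw [le_div_iff₀ (by positivity)]; nlinarith
  · rw [le_div_iff₀ h3]; nlinarith
  · apply le_of_eq
    field_simp
    ring
  · have e : (s ^ 2 - 1) / 8 - 2 * ((s ^ 2 + 3) / (2 * (s + 1)) - 1) = (s - 1) * (s - 3) ^ 2 / (8 * (s + 1)) := by
      field_simp
      ring
    have hnn : 0 ≤ (s - 1) * (s - 3) ^ 2 / (8 * (s + 1)) := div_nonneg (mul_nonneg h2.le (sq_nonneg _)) (by positivity)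
    linarith
  · apply le_of_eq
    field_simp
    ring

/-- For `λ ≥ 1`, `s = sqrt(8λ+1)` satisfies `s ≥ 3` and `(s²−1)/8 = λ`. [folklore] -/
theorem fam_param_of_lambda (lam : ℝ) (hlam : 1 ≤ lam) :
    3 ≤ Real.sqrt (8 * lam + 1) ∧ (Real.sqrt (8 * lam + 1) ^ 2 - 1) / 8 = lam := by
  have h0 : 0 ≤ 8 * lam + 1 := by linarith
  refine ⟨?_, ?_⟩
  · rw [show (3 : ℝ) = Real.sqrt 9 by rw [show (9 : ℝ) = 3 ^ 2 by norm_num, Real.sqrt_sq (by norm_num)]]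
    exact Real.sqrt_le_sqrt (by linarith)
  · rw [Real.sq_sqrt h0]; ring

/-- **The λ-row of APL-G for `λ ≥ 1` from the matching member of the family** (cells).  If `u0 > 0` and for the member
`α = (s²+3)/(2(s+1))`, `β = (s²+3)/(s²−1)`, `s = sqrt(8λ+1)`, the row `u0^{α+β} ≤ (u0+ubc)(u0+uac)^β(u0+uab)^α` holds, then
`2·(u0 − (u0+ubc)(u0+uab+uac)) ≤ λ·uab + uac/λ`. [this work] -/
theorem lambdaRow_of_member (lam u0 uab uac ubc : ℝ) (hlam : 1 ≤ lam)
    (hu0 : 0 < u0) (huab : 0 ≤ uab) (huac : 0 ≤ uac)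
    (hrow : u0 ^ ((Real.sqrt (8 * lam + 1) ^ 2 + 3) / (2 * (Real.sqrt (8 * lam + 1) + 1))
        + (Real.sqrt (8 * lam + 1) ^ 2 + 3) / (Real.sqrt (8 * lam + 1) ^ 2 - 1))
      ≤ (u0 + ubc) * (u0 + uac) ^ ((Real.sqrt (8 * lam + 1) ^ 2 + 3) / (Real.sqrt (8 * lam + 1) ^ 2 - 1))
        * (u0 + uab) ^ ((Real.sqrt (8 * lam + 1) ^ 2 + 3) / (2 * (Real.sqrt (8 * lam + 1) + 1)))) :
    2 * (u0 - (u0 + ubc) * (u0 + uab + uac)) ≤ lam * uab + uac / lam := by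
  obtain ⟨hs, hl⟩ := fam_param_of_lambda lam hlam
  obtain ⟨hα, hβ, hadm, hwa, hwb⟩ := fam_member (Real.sqrt (8 * lam + 1)) hs
  rw [hl] at hwa hwb
  exact lambdaRow_of_row _ _ lam u0 uab uac ubc hα hβ hadm (by linarith) hwa hwb hu0 huab huac hrow

/-! ### Bookkeeping: from the λ-rows to the square -/

/-- If `H > 0`, `p > 0`, `q ≥ 0` and the λ-row holds at `λ = H/p`, i.e. `2H ≤ (H/p)·p + q/(H/p)`, then `H² ≤ p·q`. [folklore] -/
theorem sq_le_of_lambdaRow (H p q : ℝ) (hH : 0 < H) (hp : 0 < p)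
    (h : 2 * H ≤ H / p * p + q / (H / p)) : H ^ 2 ≤ p * q := by
  have e1 : H / p * p = H := div_mul_cancel₀ H hp.ne'
  have e2 : q / (H / p) = q * p / H := by rw [div_div_eq_mul_div]
  rw [e1, e2] at h
  have h3 : H ≤ q * p / H := by linarith
  rw [le_div_iff₀ hH] at h3
  nlinarith

end APL

end Summit.CriticalPhenomena.PercolationContinuityZ3.Theorems
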